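import Summits.BirchSwinnertonDyer.Rank1Residual.X11b.RouteR1Halves
import Summits.BirchSwinnertonDyer.Rank1Residual.Partition.AnticyclotomicControlJSWEmbAt
import Summits.BirchSwinnertonDyer.Rank1Residual.Partition.AnticyclotomicLogConjugate
import Literature.NumberTheory.EllipticCurves.Castella2018.PAdicWaldspurgerFormula
import HarnessLib

/-!
# X11b, route R1 at `p ≥ 5` — H2 (the `p`-adic Waldspurger formula, Cas18 Thm. 3.2) DISCHARGED FROM
# PRINT: the route's open input on semistable pairs is the ONE typed OPEN statement H3
# (`R1.IMCEqOnTree`: the anticyclotomic main conjecture for Castella's `L_p(f)`)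

HONEST FRAMING (cell `b2b-bsdres`, run/shared/lean/b2b/bsd-rank1-residual/, verbatim in every
file): the goal of the cell is to DELETE the COMBINATION-SHAPED residual classes of the
Birch–Swinnerton-Dyer formula for ALL analytic-rank `≤ 1` elliptic curves over `ℚ` — "full BSD
formula for every rank `≤ 1` curve in class `C`" assembled STRICTLY from published theorems — so
that the rank-`≤ 1` remainder becomes exactly the CONSTRUCTION-SHAPED classes, which are TYPED
(missing-input `Prop`s), NOT attempted. This is not "finishing BSD". Sub-cell
`b2b-bsdres-multr1-p1` (X11b, route R1, gen 21); a RESEARCH ROUTE; no claim beyond the stated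
class; X11b stays CONSTRUCTION-SHAPED; nothing here changes a label; NO named fact is minted here
(theorems only; the PUBLISHED fact `Castella2018.thm32_exists_isBDPLFunction_valueAtOne` — Cas18
Thm. 3.2 jointly with Thm. 3.1, Literature — enters as the hypothesis `h32`; every result using the
OPEN shape H3 is CONDITIONAL; no `sorry`). Treaty with team x11b3 (OWNERS A6.3 (2)): `p ≥ 5`,
`X11b.R1.…` names, no `Three` import.

## What this file does (gen 21)

Gen 20 (`RouteR1Halves.lean`) split route R1's composite open input `(IMC)∘(BDP)@𝟙` over Castella's
published `L_p(f) ∈ Λ_{R₀}` into H1 (EXISTS, A206 — discharged), H2 (`R1.BDPValueOnTree`: the value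
at `𝟙`, Cas18 Thm. 3.2 — a typed PUB SHAPE, consumed as a hypothesis) and H3 (`R1.IMCEqOnTree`:
erratum Thm. 1.1 — OPEN). With the Literature fact `thm32_exists_isBDPLFunction_valueAtOne` (Thm. 3.1
∧ Thm. 3.2 in the `∃∧`-currency of A206: ONE frame `(Ω_K, Ω_p, L)` with the interpolation property
AND `L(𝟙) = u·((1 − a_p p⁻¹ + ε_p)·log_{ω_E} P_K)²`) H2 no longer needs to be assumed:

* §1 bridges (every `p`): the Literature reading `Castella2018.padicLogOmega` IS the receptacle's
  `Halves.logOmega` (`rfl`); reading a point along `ι ∘ τ` is reading `τ_* P` along `ι`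
  (`R1.padicLogOrd_map_eq_comp`).
* §2 **`R1.exists_frame_bdpValueAtOneOnTreeAt_of_thm32`** — at an erratum-field datum of a
  SEMISTABLE pair, for every embedding datum `ι'`, the fact yields a frame `L` at `𝔭_{ι'}` with
  `IsBDPLFunction` AND the H2-shape `R1.BDPValueAtOneOnTreeAt W p e P' L (a_p)` for the Heegner point
  `P'` read through Mathlib's embedding of the infinite place (`ε_p = 0` as `p ∣ N`); the twin
  `…_of_satisfiesHeegnerHypothesis` does the same under the CLASSICAL Heegner hypothesis (route p2's
  fields; offered to sub-cell multr1-p2).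
* §3 **`R1.openInputOnTreeAt_of_imcEq`** — `R1OpenInputOnTreeAt W p` on a semistable pair from the
  PUBLISHED facts `h32` (Cas18 Thms. 3.1–3.2), `hmod`, `hGZK`, the five CITED control facts, and the
  ONE OPEN input H3 = `R1.IMCEqOnTree W p`. Per datum `(q, K, Dt, H, ι_K, P, κ, γ, 𝔭)`: `𝔭 = 𝔭_{ι'}`
  for `ι' ∈ {ι, ι∘conj}` (`eq_primeOfEmbeddingDatum_or_eq_trans_starRingAut`); `ι_K = w₀.embedding ∘ τ`
  for some `τ ∈ Gal(K/ℚ)` (Mathlib `ComplexEmbedding.exists_comp_symm_eq_of_comp_eq`), so the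
  Galois conjugate `P' = τ_* P` is the Heegner point in the fact's reading; THE embedding
  `embAt K p 𝔭` induces `𝔭` (`mem_asIdeal_iff_norm_embAt_lt_one`); the fact gives the frame and H2 at
  `P'`, H3 gives the IMC at that frame, CTL₀ is gen 18's theorem, the pointwise assembly is gen 20's
  `R1.imcWaldspurgerOnTreeAt_of_halves`; finally `ord_p log_{ω_E} P' = ord_p log_{ω_E} P` because
  `rank_ℤ E(K) = 1` on an erratum field (GZK) and `τ` is an involution
  (`padicLogOrd_comp_eq_of_rank_one`, lit-cgls).
* §4 **`R1.bsdp_of_imcEq_final`** — statement of record (gen 21): `BSD_p` on semistable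
  `R1Population ∩ {r_an = 1}` from EIGHT PUBLISHED named facts (Gross–Zagier I.7.3, GZK, Skinner 2016
  Thm. C, modularity, Cai–Shu–Tian, Friedberg–Hoffstein, Mazur's Manin, Castella 2018 Thms. 3.1–3.2)
  + FIVE CITED cohomological facts + ONE OPEN input H3. Compared with gen 20's
  `R1.bsdp_of_halves_final`: the hypothesis `h2 : R1.BDPValueOnTree W p` is GONE and A206 (`hBDP`)
  is subsumed by `h32`.

CONDITIONAL on H3 (open); deletes nothing; X11b stays CONSTRUCTION-SHAPED; no label change.

References: [Castella2018] Thm. 2.3, Thm. 3.1, (3.2), Thm. 3.2, §5 (arXiv:1704.06608 pp. 5, 9, 12);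
[Castella2018Erratum] Thm. 1.1 (p. 1); [FouquetWan2021] Thm. 4.41; [CastellaHsieh2018] §3.3.
-/

noncomputable section

open scoped Classical


open WeierstrassCurve NumberField IsDedekindDomain Field PowerSeries
open Literature.NumberTheory.EllipticCurves Literature.NumberTheory.EllipticCurves.GreenbergSelmer
open Literature.NumberTheory.EllipticCurves.ModularForms
open Literature.NumberTheory.EllipticCurves.Rank1Residual
open Literature.NumberTheory.EllipticCurves.Rank1Residual.Typed
open Literature.NumberTheory.EllipticCurves.Castella2018
open Literature.NumberTheory.GaloisRepresentations
open Literature.NumberTheory.GaloisCohomology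
open Summit.BirchSwinnertonDyer.Rank1Residual.X11b.AcSelmer
open Summit.BirchSwinnertonDyer.Rank1Residual.X11b.Halves

namespace Summit.BirchSwinnertonDyer.Rank1Residual.X11b

/-! ### §1 Bridges (every `p`) -/

section Bridges

variable (W : WeierstrassCurve ℚ) [W.IsElliptic] [W.IsGloballyMinimal] (p : ℕ) [Fact p.Prime]
  {K : Type} [Field K] [NumberField K] (ι : K →+* ℚ_[p]) (P : (W.baseChange K).toAffine.Point)

/-- The receptacle's `log_{ω_E} P ∈ ℚ_p` (`Halves.logOmega`, team x11b3 / route R1) IS the Literature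
reading `Castella2018.padicLogOmega` of the same printed symbol: `rfl`.
[cite: Castella2018, Thm. 3.2 (arXiv:1704.06608 p. 9) (the symbol `log_{ω_E} P_K`)] -/
theorem R1.logOmega_eq_padicLogOmega : logOmega W p ι P = padicLogOmega W p ι P := rfl

/-- **Reading a point along `ι ∘ τ` is reading `τ_* P` along `ι`** for the cell's
`ord_p log_{ω_E}` (`X11b.padicLogOrd`): `padicLogOrd W p ι (τ_* P) = padicLogOrd W p (ι ∘ τ) P`
(lit-cgls's `padicPointOf_comp`). [folklore] -/
theorem R1.padicLogOrd_map_eq_comp (τ : K →+* K) :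
    padicLogOrd W p ι (WeierstrassCurve.Affine.Point.map τ.toRatAlgHom P) =
      padicLogOrd W p (ι.comp τ) P := by
  rw [padicLogOrd_eq_literature, padicLogOrd_eq_literature,
    Literature.NumberTheory.EllipticCurves.padicLogOrd,
    Literature.NumberTheory.EllipticCurves.padicLogOrd, padicPointOf_comp]

/-- **`ord_p log_{ω_E}(τ_* P) = ord_p log_{ω_E} P`** along one embedding `ι : K → ℚ_p`, for an
involution `τ` of `K`, `p ≠ 2`, `rank_ℤ E(K) = 1` and `P` of infinite order (lit-cgls's
`padicLogOrd_comp_eq_of_rank_one`: `τ_* P = ±P + torsion`, torsion dies in `E₁(ℚ_p)`).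
[cite: CastellaGrossiLeeSkinner2022, Thm. 5.1.1 (the reading note on the prime of the logarithm)] -/
theorem R1.padicLogOrd_map_eq_of_rank_one (hp : p ≠ 2) (τ : K →+* K) (hτ : ∀ x, τ (τ x) = x)
    (hrk : (W.baseChange K).mordellWeilRank = 1) (hP : ¬ IsOfFinAddOrder P) :
    padicLogOrd W p ι (WeierstrassCurve.Affine.Point.map τ.toRatAlgHom P) = padicLogOrd W p ι P := by
  rw [R1.padicLogOrd_map_eq_comp, padicLogOrd_eq_literature, padicLogOrd_eq_literature]
  exact padicLogOrd_comp_eq_of_rank_one W p hp τ hτ ι hrk P hP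

omit [W.IsElliptic] [W.IsGloballyMinimal] in
/-- Transport of the composite link along `P ↦ τ_* P` when the two logarithm orders agree.
[folklore] -/
theorem R1.imcWaldspurgerOnTreeAt_of_padicLogOrd_eq [W.IsElliptic] [W.IsGloballyMinimal]
    {κ : ZpExtension K p} {𝔭 : HeightOneSpectrum (𝓞 K)} {γ : Field.absoluteGaloisGroup K}
    [Fact (κ.IsTopGenerator γ)] {P P' : (W.baseChange K).toAffine.Point}
    (hlog : padicLogOrd W p ι P' = padicLogOrd W p ι P) (h : IMCWaldspurgerOnTreeAt p κ 𝔭 γ ι P') :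
    IMCWaldspurgerOnTreeAt p κ 𝔭 γ ι P := by
  obtain ⟨n, hn, hneq⟩ := h
  exact ⟨n, hn, by rw [hneq, hlog]⟩

end Bridges

/-! ### §2 H2 at an erratum-field datum, from the published fact -/

section Pointwise

variable {p : ℕ} [Fact p.Prime] {W : WeierstrassCurve ℚ} [W.IsElliptic] [W.IsGloballyMinimal]
  [NeZero (W.conductorNorm ℤ)] {K : Type} [Field K] [NumberField K] {q : ℕ}

/-- **Cas18 Thms. 3.1–3.2 INSTANTIATED at an erratum-field datum of a semistable pair.** For a
SEMISTABLE pair with the erratum's A′-hypotheses (`5 ≤ p`, multiplicative `p`, `E[p]` irreducible),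
an erratum field `K` for `q ≠ p` (so `p` splits and every `ℓ ∣ N_E` has a degree-one prime), a
parametrisation datum `Dt` at level `N_E` with `p ∤ c` (display (3.2)), a Heegner datum `H`, a point
`P'` with `P'.map w₀.embedding = heegnerPointComplex Dt H` (Mathlib's embedding of the infinite place
`w₀`), anticyclotomic `(κ, γ)`, an embedding datum `ι'` and an embedding `e : K → ℚ_p` inducing the
prime `𝔭_{ι'}`: there is a frame `(Ω_K ≠ 0, Ω_p ∈ R₀ˣ, L)` with `IsBDPLFunction ι' 𝔭_{ι'} κ γ f Ω_K Ω_p L`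
for the newform `f = Dt.f` AND the H2-shape `R1.BDPValueAtOneOnTreeAt W p e P' L (a_p(E))`
(`ε_p = 0` since `p ∣ N_E`). CONDITIONAL on the published fact `h32`.
[cite: Castella2018, Thm. 3.1, display (3.2) and Thm. 3.2 (arXiv:1704.06608 p. 9)] -/
theorem R1.exists_frame_bdpValueAtOneOnTreeAt_of_thm32
    (h32 : thm32_exists_isBDPLFunction_valueAtOne) (ι' : PadicAlgCl p ≃+* ℂ)
    (Dt : ModularParametrizationData W (W.conductorNorm ℤ))
    (H : HeegnerDatum (W.conductorNorm ℤ) (NumberField.discr K)) (hE : ErratumHypotheses W p)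
    (hss : Semistable W) [Fact q.Prime] (hqp : q ≠ p) (hK : IsErratumField W K q)
    (hc : ¬ (p : ℤ) ∣ Dt.c) (w₀ : InfinitePlace K) {P' : (W.baseChange K).toAffine.Point}
    (hP' : WeierstrassCurve.Affine.Point.map w₀.embedding.toRatAlgHom P' = heegnerPointComplex Dt H)
    (κ : ZpExtension K p) (hκ : κ.IsAnticyclotomic) (γ : Field.absoluteGaloisGroup K)
    [hγ : Fact (κ.IsTopGenerator γ)] {e : K →+* ℚ_[p]}
    (he : ∀ k : 𝓞 K, k ∈ (primeOfEmbeddingDatum p ι' w₀.embedding).asIdeal ↔ ‖e (k : K)‖ < 1) :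
    ∃ (ΩK : ℂ) (Ωp : (unrIntegers p)ˣ) (L : UnrSeries p), ΩK ≠ 0 ∧
      IsBDPLFunction ι' (primeOfEmbeddingDatum p ι' w₀.embedding) κ γ Dt.f ΩK
        ((Ωp : unrIntegers p) : ℂ_[p]) L ∧
      R1.BDPValueAtOneOnTreeAt W p e P' L (W.LFunction p) := by
  have hpN : p ∣ W.conductorNorm ℤ := dvd_conductorNorm_of_mult hE.2.1
  obtain ⟨ΩK, Ωp, L, hΩ, hL, u, hu⟩ :=
    h32 ι' W K (primeOfEmbeddingDatum p ι' w₀.embedding) κ γ Dt H w₀ e P' hE.1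
      (squarefree_conductorNorm_of_semistable hss) hE.2.2.1 hK.1
      (hK.ncard_primesOver_eq_two Fact.out hpN hqp)
      (natCast_mem_primeOfEmbeddingDatum p ι' w₀.embedding)
      (forall_mem_primeOfEmbeddingDatum_iff p ι' hK.1 w₀) (hK.forall_exists_absNorm_eq Fact.out)
      hκ hγ.out hc hP' he
  refine ⟨ΩK, Ωp, L, hΩ, hL, u, ?_⟩
  rw [valueShape_of_dvd hpN] at hu
  rw [R1.logOmega_eq_padicLogOmega]
  exact hu

/-- **Cas18 Thms. 3.1–3.2 INSTANTIATED under the CLASSICAL Heegner hypothesis** (route p2's / JSW's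
fields: every prime of `N_E` split in `K`; offered to sub-cell multr1-p2, whose open input
`P2OpenInputOnTreeAt` quantifies over such `K`). For `p ≥ 5`, `E` semistable with `ρ̄_{E,p}`
irreducible and `p ∣ N_E`, `K` imaginary quadratic with the Heegner hypothesis for `N_E`, a datum
`Dt` at level `N_E` with `p ∤ c`, a Heegner datum `H`, `P'` with `P'.map w₀.embedding =
heegnerPointComplex Dt H`, anticyclotomic `(κ, γ)`, an embedding datum `ι'` and `e : K → ℚ_p`
inducing `𝔭_{ι'}`: a frame `(Ω_K ≠ 0, Ω_p, L)` with `IsBDPLFunction ι' 𝔭_{ι'} κ γ f Ω_K Ω_p L` AND the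
H2-shape `R1.BDPValueAtOneOnTreeAt W p e P' L (a_p(E))`. CONDITIONAL on `h32`.
[cite: Castella2018, Thm. 3.1, display (3.2) and Thm. 3.2 (arXiv:1704.06608 p. 9)]
[cite: GrossLMS1991, §1 (p. 235)] -/
theorem R1.exists_frame_bdpValueAtOneOnTreeAt_of_satisfiesHeegnerHypothesis
    (h32 : thm32_exists_isBDPLFunction_valueAtOne) (ι' : PadicAlgCl p ≃+* ℂ)
    (Dt : ModularParametrizationData W (W.conductorNorm ℤ))
    (H : HeegnerDatum (W.conductorNorm ℤ) (NumberField.discr K)) (h5 : 5 ≤ p) (hss : Semistable W)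
    (hirr : Irr W p) (hpN : p ∣ W.conductorNorm ℤ) (hK : IsImaginaryQuadratic K)
    (hH : SatisfiesHeegnerHypothesis (W.conductorNorm ℤ) K) (hc : ¬ (p : ℤ) ∣ Dt.c)
    (w₀ : InfinitePlace K) {P' : (W.baseChange K).toAffine.Point}
    (hP' : WeierstrassCurve.Affine.Point.map w₀.embedding.toRatAlgHom P' = heegnerPointComplex Dt H)
    (κ : ZpExtension K p) (hκ : κ.IsAnticyclotomic) (γ : Field.absoluteGaloisGroup K)
    (hγ : κ.IsTopGenerator γ) {e : K →+* ℚ_[p]}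
    (he : ∀ k : 𝓞 K, k ∈ (primeOfEmbeddingDatum p ι' w₀.embedding).asIdeal ↔ ‖e (k : K)‖ < 1) :
    ∃ (ΩK : ℂ) (Ωp : (unrIntegers p)ˣ) (L : UnrSeries p), ΩK ≠ 0 ∧
      IsBDPLFunction ι' (primeOfEmbeddingDatum p ι' w₀.embedding) κ γ Dt.f ΩK
        ((Ωp : unrIntegers p) : ℂ_[p]) L ∧
      R1.BDPValueAtOneOnTreeAt W p e P' L (W.LFunction p) := by
  obtain ⟨ΩK, Ωp, L, hΩ, hL, u, hu⟩ :=
    h32 ι' W K (primeOfEmbeddingDatum p ι' w₀.embedding) κ γ Dt H w₀ e P' h5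
      (squarefree_conductorNorm_of_semistable hss) hirr hK (hH p Fact.out hpN)
      (natCast_mem_primeOfEmbeddingDatum p ι' w₀.embedding)
      (forall_mem_primeOfEmbeddingDatum_iff p ι' hK w₀)
      (fun ℓ hℓ hℓN ↦ exists_absNorm_eq_of_splitsIn hK.1 hℓ (hH ℓ hℓ hℓN)) hκ hγ hc hP' he
  refine ⟨ΩK, Ωp, L, hΩ, hL, u, ?_⟩
  rw [valueShape_of_dvd hpN] at hu
  rw [R1.logOmega_eq_padicLogOmega]
  exact hu

end Pointwise

/-! ### §3 The open input of route R1 from the published facts and H3 alone -/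

section ClassLevel

variable {W : WeierstrassCurve ℚ} [W.IsElliptic] [W.IsGloballyMinimal] {p : ℕ} [Fact p.Prime]

/-- **Route R1's open input FROM PRINT ∧ H3, on a semistable pair at `p ≥ 5`.** Given the PUBLISHED
facts `h32` (Cas18 Thm. 3.2 jointly with Thm. 3.1: H1 EXISTS and H2 the value at `𝟙`), `hmod`
(modularity), `hGZK`, the CITED cohomological facts of the control theorem (`hPT`, `hPT2`, `hEP`,
`hcd`, `hBr` — which make `R1ControlOnTreeAt W p` a THEOREM, gen 18), a SEMISTABLE pair, ONE embedding
datum `ι : ℚ̄_p ≃ ℂ`, and the ONE TYPED OPEN input H3 (`R1.IMCEqOnTree W p`: erratum Thm. 1.1, the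
anticyclotomic IMC `Ch_Λ(X_ac)·Λ_{R₀} = (L)` at every BDP frame): `R1OpenInputOnTreeAt W p` — at EVERY
datum, every anticyclotomic `(κ, γ)` and EVERY degree-one `𝔭 ∣ p` with THE embedding `embAt K p 𝔭`.
Per datum: `𝔭 = 𝔭_{ι'}` for `ι' ∈ {ι, ι ∘ conj}`; the datum's complex embedding is `w₀.embedding ∘ τ`
for a `τ ∈ Gal(K/ℚ)`, so `τ_* P` is the Heegner point in the fact's reading; `embAt K p 𝔭` induces
`𝔭`; H2 at `τ_* P` and H1 come from `h32`, H3 at the same frame from `h3`, CTL₀ from gen 18, and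
`ord_p log_{ω_E}(τ_* P) = ord_p log_{ω_E} P` (`rank_ℤ E(K) = 1` on an erratum field, `τ² = 1`).
CONDITIONAL on H3 (open). [cite: Castella2018, Thms. 2.3, 3.1, 3.2 and §5 (arXiv:1704.06608 pp. 5, 9, 12)]
[cite: Castella2018Erratum, Thm. 1.1 (p. 1)] -/
theorem R1.openInputOnTreeAt_of_imcEq (h32 : thm32_exists_isBDPLFunction_valueAtOne)
    (hmod : exists_isNewformOf) (hGZK : rank_eq_analyticRank_of_analyticRank_le_one)
    (hPT : ∀ (K : Type) [Field K] [NumberField K], poitouTate_selmerStructure_duality K)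
    (hPT2 : ∀ (K : Type) [Field K] [NumberField K], poitouTate_sha_tateDual K)
    (hEP : ∀ (K : Type) [Field K] [NumberField K] (v : HeightOneSpectrum (𝓞 K)),
      localEulerPoincareCharacteristic (v.adicCompletion K))
    (hcd : fieldCdLE_two_of_numberField)
    (hBr : ∀ (K : Type) [Field K] [NumberField K] (p : ℕ) [Fact p.Prime],
      ZpExtension.decomp_not_le_kerSubgroup_of_isAnticyclotomic K p)
    (ι : PadicAlgCl p ≃+* ℂ) (hss : Semistable W) (h3 : R1.IMCEqOnTree W p) :
    R1OpenInputOnTreeAt W p := by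
  intro _ q _ K _ _ Dt H ιK P hE hr hqp hmq hns hvq hK hCas hP hc hinf κ hκ γ _ 𝔭 h𝔭 he hf
  have hC : R1ControlOnTreeAt W p :=
    r1ControlOnTreeAt_of_poitouTateAtoms_of_anticyclotomicDecomposition W p hBr
      (r1PoitouTateAtomsAt_of_twoAtoms W p hPT hEP
        (r1TwoAtomsAt_of_baseSelmerCount W p hPT hPT2 hEP hcd
          (r1BaseSelmerCountAt_of_facts W p hGZK hmod hPT hEP)))
  obtain ⟨n, hn, -⟩ := hC q K Dt H ιK P hE hr hqp hmq hns hvq hK hCas hP hc hinf κ hκ γ 𝔭 h𝔭 he hf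
  obtain ⟨w₀⟩ := (inferInstance : Nonempty (InfinitePlace K))
  have hnd : ¬ (p : ℤ) ∣ W.LFunction p := R1.not_dvd_lFunction_of_mult Dt.isNewformOf hE.2.1
  have hp2 : p ≠ 2 := by have := hE.1; omega
  -- `rank_ℤ E(K) = 1` on the erratum field (Gross–Zagier–Kolyvagin)
  have hrk : (W.baseChange K).mordellWeilRank = 1 :=
    (IsErratumField.mordellWeilRank_eq_one_and_shaFinite W hGZK hmod hr hK).1
  -- the datum's complex embedding is `w₀.embedding ∘ τ` for some `τ ∈ Gal(K/ℚ)`, `τ² = 1`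
  haveI : IsGalois ℚ K := by
    haveI : Algebra.IsQuadraticExtension ℚ K := ⟨hK.1.1⟩
    infer_instance
  obtain ⟨σ, hσ⟩ := ComplexEmbedding.exists_comp_symm_eq_of_comp_eq (k := ℚ) w₀.embedding ιK
    (by ext x; simp)
  set τ : K →+* K := ((σ.symm : K ≃ₐ[ℚ] K) : K →+* K) with hτdef
  have hτ : ∀ x, τ (τ x) = x := by
    intro x
    have hcard : Nat.card (K ≃ₐ[ℚ] K) = 2 := by rw [IsGalois.card_aut_eq_finrank, hK.1.1]
    have hsq : σ.symm * σ.symm = 1 := by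
      have h := pow_card_eq_one' (G := K ≃ₐ[ℚ] K) (x := σ.symm)
      rwa [hcard, pow_two] at h
    have := congrArg (fun g : K ≃ₐ[ℚ] K ↦ g x) hsq
    simpa [hτdef, AlgEquiv.mul_apply] using this
  -- the Galois conjugate `P' = τ_* P` is the Heegner point read through `w₀.embedding`
  set P' := WeierstrassCurve.Affine.Point.map τ.toRatAlgHom P with hP'def
  have hP' : WeierstrassCurve.Affine.Point.map w₀.embedding.toRatAlgHom P' =
      heegnerPointComplex Dt H := by
    rw [hP'def, WeierstrassCurve.Affine.Point.map_map]
    have hcomp : w₀.embedding.toRatAlgHom.comp τ.toRatAlgHom = ιK.toRatAlgHom := by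
      apply AlgHom.ext
      intro x
      have := RingHom.congr_fun hσ x
      simpa [hτdef] using this
    rw [hcomp]
    exact hP
  -- `ord_p log P' = ord_p log P` along any embedding
  have hlog : ∀ e : K →+* ℚ_[p], padicLogOrd W p e P' = padicLogOrd W p e P := fun e ↦
    R1.padicLogOrd_map_eq_of_rank_one W p e P hp2 τ hτ hrk hinf
  -- THE embedding at `𝔭` induces `𝔭`
  have hemb : ∀ k : 𝓞 K, k ∈ 𝔭.asIdeal ↔ ‖embAt K p 𝔭 h𝔭 he hf (k : K)‖ < 1 :=
    mem_asIdeal_iff_norm_embAt_lt_one 𝔭 h𝔭 he hf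
  -- every degree-one prime above `p` is induced by `ι` or by `ι ∘ conj`
  have key : ∀ ι' : PadicAlgCl p ≃+* ℂ, 𝔭 = primeOfEmbeddingDatum p ι' w₀.embedding →
      IMCWaldspurgerOnTreeAt p κ 𝔭 γ (embAt K p 𝔭 h𝔭 he hf) P := by
    intro ι' h𝔭eq
    subst h𝔭eq
    obtain ⟨ΩK, Ωp, L, -, hL, h2⟩ :=
      R1.exists_frame_bdpValueAtOneOnTreeAt_of_thm32 h32 ι' Dt H hE hss hqp hK hc w₀ hP' κ hκ γ hemb
    refine R1.imcWaldspurgerOnTreeAt_of_padicLogOrd_eq W p _ (hlog _) ?_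
    exact R1.imcWaldspurgerOnTreeAt_of_halves hn
      (h3 q K Dt H ιK P hE hr hqp hmq hns hvq hK hCas hP hc hinf Dt.f Dt.isNewformOf κ hκ γ ι' w₀
        ΩK Ωp L hL)
      hnd h2
  rcases eq_primeOfEmbeddingDatum_or_eq_trans_starRingAut p ι hK.1 w₀ h𝔭 with h | h
  · exact key ι h
  · exact key _ h

/-- **Route R1 — statement of record (gen 21), semistable pairs, `p ≥ 5`: ONE OPEN INPUT.** For
every globally minimal SEMISTABLE elliptic `W/ℚ` and prime `p` on `R1Population` with
`ord_{s=1} L(E,s) = 1`: `BSD(E,p)`, from EIGHT PUBLISHED named facts (Gross–Zagier I.7.3, GZK, Skinner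
2016 Thm. C, modularity, Cai–Shu–Tian, Friedberg–Hoffstein, Mazur's Manin — and Castella 2018
Thms. 3.1–3.2 = `h32`: EXISTENCE of `L_p(f) ∈ Λ_{R₀}` with its value at `𝟙`), the FIVE CITED
cohomological facts of gen 18, one embedding datum `ι`, and the ONE OPEN input H3
(`R1.IMCEqOnTree W p`: erratum Thm. 1.1 — the anticyclotomic main conjecture
`Ch_Λ(X_ac(E[p^∞]))·Λ_{R₀} = (L_p(f))` for Castella's published `L_p(f)` — ⇐ [FW21, Thm. 4.41],
PREPRINT). Compared with `R1.bsdp_of_halves_final` (gen 20): the typed value-formula hypothesis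
`h2 : R1.BDPValueOnTree W p` is DISCHARGED from print and A206 (`hBDP`) is subsumed by `h32`.
CONDITIONAL; deletes nothing; X11b stays CONSTRUCTION-SHAPED; no label change.
[cite: Castella2018, §5 (arXiv:1704.06608 p. 12)] [cite: Castella2018Erratum, Thm. 1.1, Thm. A′ (p. 1)] -/
theorem R1.bsdp_of_imcEq_final
    (hGZ : GrossZagier1986_thm_I_7_3) (hGZK : rank_eq_analyticRank_of_analyticRank_le_one)
    (hSk : Skinner2016.thmC_padicValRat_bsd_rank_zero) (hmod : exists_isNewformOf)
    (hCST : CaiShuTian2014.thm11_trivialChar)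
    (hFH : friedbergHoffstein_exists_twist_ne_zero_ramifiedAt)
    (hMaz : mazur_not_dvd_maninConstant_of_odd) (h32 : thm32_exists_isBDPLFunction_valueAtOne)
    (hPT : ∀ (K : Type) [Field K] [NumberField K], poitouTate_selmerStructure_duality K)
    (hPT2 : ∀ (K : Type) [Field K] [NumberField K], poitouTate_sha_tateDual K)
    (hEP : ∀ (K : Type) [Field K] [NumberField K] (v : HeightOneSpectrum (𝓞 K)),
      localEulerPoincareCharacteristic (v.adicCompletion K))
    (hcd : fieldCdLE_two_of_numberField)
    (hBr : ∀ (K : Type) [Field K] [NumberField K] (p : ℕ) [Fact p.Prime],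
      ZpExtension.decomp_not_le_kerSubgroup_of_isAnticyclotomic K p)
    (ι : PadicAlgCl p ≃+* ℂ) (hss : Semistable W) (h3 : R1.IMCEqOnTree W p) (hW : R1Population W p)
    (hr : W.analyticRank = 1) : BSDp W p :=
  (R1.openInputOnTreeAt_iff_bsdp_final (W := W) (p := p) hGZ hGZK hSk hmod hCST hFH hMaz hPT hPT2
      hEP hcd hBr hW hr).mp
    (R1.openInputOnTreeAt_of_imcEq h32 hmod hGZK hPT hPT2 hEP hcd hBr ι hss h3)

end ClassLevel

end Summit.BirchSwinnertonDyer.Rank1Residual.X11b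

end
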